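import Summits.Ventures.HSemireg.WedgeHankelRecurrenceGaussMarkovNonneg

/-!
# Venture HSemireg — **WEYL'S INTERLACING INEQUALITIES FOR LOW-RANK CHANGES OF THE RECURRENCE**: if two positive recurrences `(a, b)`, `(a', b')` differ (upwards in `a`, anyhow in `b`) only on
# indices covered by a set `Z` of `m` coordinates, then the `k`-th zero of `q'_{t+1}` is at most the `(k+m)`-th zero of `q_{t+1}`: `y_k ≤ x_{k+m}`; in particular a SINGLE diagonal entry
# `a_i ↦ a_i + c` (`c ≥ 0`) gives `x_k ≤ y_k ≤ x_{k+1}` (rank one), and a SINGLE coupling `b_j ↦ b'_j` gives `x_{k−1} ≤ y_k ≤ x_{k+1}` (rank two, one eigenvalue of each sign)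

HONEST FRAMING. Part of the Lean index of the computation cell `pub-hsemireg` (seat p10 gen 45, Sunday typer «UNIFORM-IN-n»).  Real polynomials, finite sums, `Real.sqrt` and one rank–nullity
count (`LinearMap.ker_ne_bot_of_finrank_lt`) only; no variety, no cohomology theory, no sheaf, no Ext group and no semiregularity map is constructed here; nothing here says that HC / HC_CM /
HC_AV holds; no Literature fact (unproved `Prop`) is declared or used.  Custodian versions as in `WedgeHankelSiegelIdeal` (1/3).
SOURCES (cited).  H. Weyl, *Das asymptotische Verteilungsgesetz der Eigenwerte linearer partieller Differentialgleichungen*, Math. Ann. 71 (1912) 441–479 (the inequalities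
`λ_k(A + B) ≤ λ_{k+r}(A)` for `B` with at most `r` positive eigenvalues); R. A. Horn, C. R. Johnson, *Matrix Analysis* (2nd ed.) Thm 4.3.1, Cor. 4.3.9 (rank-one ∕ rank-`r` interlacing);
B. N. Parlett, *The Symmetric Eigenvalue Problem* (1980) §10.3; for Jacobi matrices M. E. H. Ismail, *Classical and Quantum Orthogonal Polynomials* (2005) §7.3.
PROOF TYPED HERE (no matrices).  As in N323 ∕ N325: Favard weights at the zeros (N323 `favard_pairing_at_zeros`) turn `P = Σ v_i q_i` into coordinates with `Σ μ P² = Σ h_i v_i²` and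
`Σ μ x P² = Σ a_i h_i v_i² + 2 Σ h_{i+1} v_i v_{i+1}` (`h_i = b_1⋯b_i`); the rescaling `u_i = v_i √(h_i∕h'_i)` transports `v` to the second recurrence with the same norm, the same diagonal
terms up to `(a'_i − a_i) h_i v_i²`, and the SAME cross terms wherever `b_{i+1} = b'_{i+1}`.  Killing the coordinates in `Z` (`m` conditions), the values of `P'_u` at `y_j`, `j < k` (`k`
conditions) and of `P_v` at `x_j`, `j > k + m` (`t − k − m` conditions) leaves a non-zero `v` (rank–nullity), and then `y_k Σ h v² ≤ Σ μ' y P'_u² ≤ Σ μ x P_v² ≤ x_{k+m} Σ h v²`.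
DEDUP DISCLOSURE (`rg -n 'weyl|rank_one|interlace_single|shift' Summits/Ventures/HSemireg`, 2026-09-03): N323 (`zeros_mono_diagonal`, all `a_i` move), N324 (`zeros_perturbation_diagonal`, sup bound),
N325 (extreme zeros vs `b`), N333 ∕ N338 (top ∕ first entry, via interlacing polynomials) are the neighbours; the index-shift inequalities for changes on an arbitrary coordinate set are new.
The 8 names below: 0 hits tree-wide.

WHAT IS IN THE TREE.  N323 `favard_pairing_at_zeros`, `favard_norm_sq_combination`, `favard_x_pairing`, `weighted_sq_combination_expand`, `zeros_mono_diagonal`; N325 `prod_Ico_one_succ_succ`,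
`sqrt_rescale_sq`; Mathlib `LinearMap.ker_ne_bot_of_finrank_lt`, `Module.finrank_fintype_fun_eq_card`.
THIS FILE (namespace `Summit.Ventures.HSemireg.Wedge.HankelOuter` continued; CHAINED on N345 (import only); 0 definitions):
* §1111 `exists_test_vector_of_card_lt` (`< t+1` homogeneous linear conditions on `ℝ^{t+1}` have a non-zero solution), `favard_forms_rescaled` (norm and `x`-form of the rescaled vector:
  `Σ μ' P'_u² = Σ h v²`, `Σ μ' y P'_u² − Σ μ x P_v² = Σ (a'_i − a_i) h_i v_i²` when `v_i v_{i+1} = 0` wherever `b_{i+1} ≠ b'_{i+1}`), **`zeros_weyl_upper`** (`y_k ≤ x_{k+m}` for changes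
  covered by `Z`, `|Z| ≤ m`), **`zeros_weyl_lower`** (`x_k ≤ y_{k+m}`, the mirror statement), **`zeros_rank_one_interlace`** (one diagonal entry raised: `x_k ≤ y_k ≤ x_{k+1}`),
  **`zeros_single_coupling_interlace`** (one `b_j` changed: `x_{k−1} ≤ y_k ≤ x_{k+1}`, stated as `y_k ≤ x_{k+1}` and `x_k ≤ y_{k+1}`), `zeros_diagonal_support_upper` ∕ `_lower` (diagonal
  changes on a set `S ⊆ ℕ` of `≤ m` indices, `b = b'`).
CAVEATS.  Positive recurrences (`b, b' > 0`); zeros presented as increasing vectors with `q_{t+1} = ∏ (X − x_j)`.  Nothing Ext-side.  New names only.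
-/

open Module Polynomial
open scoped Matrix Polynomial

namespace Summit.Ventures.HSemireg.Wedge.HankelOuter

/-! ## §1111. Weyl's inequalities for low-rank changes of the recurrence coefficients -/

/-- **Fewer than `t + 1` homogeneous linear conditions on `ℝ^{t+1}` have a non-zero common solution** (rank–nullity). [folklore; this file, §1111] -/
theorem exists_test_vector_of_card_lt {t : ℕ} {ι : Type*} [Fintype ι] (e : ι → Fin (t + 1) → ℝ) (hι : Fintype.card ι < t + 1) :
    ∃ v : Fin (t + 1) → ℝ, v ≠ 0 ∧ ∀ r, ∑ i, v i * e r i = 0 := by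
  classical
  obtain ⟨M, hM⟩ : ∃ M : Matrix ι (Fin (t + 1)) ℝ, M = Matrix.of fun r i => e r i := ⟨_, rfl⟩
  have h : Module.finrank ℝ (ι → ℝ) < Module.finrank ℝ (Fin (t + 1) → ℝ) := by
    rw [Module.finrank_fintype_fun_eq_card, Module.finrank_fintype_fun_eq_card, Fintype.card_fin]; exact hι
  have hker := LinearMap.ker_ne_bot_of_finrank_lt (f := M.mulVecLin) h
  obtain ⟨v, hv, hv0⟩ := Submodule.exists_mem_ne_zero_of_ne_bot hker
  refine ⟨v, hv0, fun r => ?_⟩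
  have h1 : (M.mulVecLin v) r = 0 := by rw [LinearMap.mem_ker.1 hv]; rfl
  rw [Matrix.mulVecLin_apply, Matrix.mulVec, dotProduct] at h1
  rw [← h1, hM]
  exact Finset.sum_congr rfl fun i _ => by rw [Matrix.of_apply, mul_comm]

/-- **The rescaled coordinate vector.**  For two positive recurrences with Favard pairings `(μ, x)`, `(μ', y)` at the zeros and `u_i = v_i √(h_i ∕ h'_i)` (`h_i = b_1⋯b_i`, `h'_i = b'_1⋯b'_i`):
`Σ μ' P'_u² = Σ h_i v_i²`, and if `v_i v_{i+1} = 0` wherever `b_{i+1} ≠ b'_{i+1}` then `Σ μ' y P'_u² − Σ μ x P_v² = Σ (a'_i − a_i) h_i v_i²` (`P_v = Σ v_i q_i`, `P'_u = Σ u_i q'_i`).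
[N323 `favard_x_form_sub` with N325's rescaling; this file, §1111] -/
theorem favard_forms_rescaled {q q' : ℕ → ℝ[X]} {a a' b b' : ℕ → ℝ} (hq0 : q 0 = 1) (hq1 : q 1 = Polynomial.X - C (a 0))
    (hrec : ∀ n, q (n + 2) = (Polynomial.X - C (a (n + 1))) * q (n + 1) - C (b (n + 1)) * q n)
    (hq0' : q' 0 = 1) (hq1' : q' 1 = Polynomial.X - C (a' 0)) (hrec' : ∀ n, q' (n + 2) = (Polynomial.X - C (a' (n + 1))) * q' (n + 1) - C (b' (n + 1)) * q' n)
    (hb : ∀ j, 0 < b j) (hb' : ∀ j, 0 < b' j)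
    {t : ℕ} {μ x μ' y : Fin (t + 1) → ℝ} (hxr : ∀ k, (q (t + 1)).eval (x k) = 0) (hyr : ∀ k, (q' (t + 1)).eval (y k) = 0)
    (hpair : ∀ i j : Fin (t + 1), ∑ k, μ k * ((q i).eval (x k) * (q j).eval (x k)) = if i = j then ∏ l ∈ Finset.Ico 1 ((j : ℕ) + 1), b l else 0)
    (hpair' : ∀ i j : Fin (t + 1), ∑ k, μ' k * ((q' i).eval (y k) * (q' j).eval (y k)) = if i = j then ∏ l ∈ Finset.Ico 1 ((j : ℕ) + 1), b' l else 0)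
    (v u : Fin (t + 1) → ℝ) (hu : ∀ i, u i = v i * Real.sqrt ((∏ l ∈ Finset.Ico 1 ((i : ℕ) + 1), b l) / ∏ l ∈ Finset.Ico 1 ((i : ℕ) + 1), b' l)) :
    ∑ k, μ' k * ((∑ i : Fin (t + 1), C (u i) * q' i).eval (y k)) ^ 2 = ∑ i : Fin (t + 1), (∏ l ∈ Finset.Ico 1 ((i : ℕ) + 1), b l) * v i ^ 2 ∧
    ((∀ i j : Fin (t + 1), (i : ℕ) + 1 = j → b j ≠ b' j → v i * v j = 0) →
      ∑ k, μ' k * (y k * ((∑ i : Fin (t + 1), C (u i) * q' i).eval (y k)) ^ 2) - ∑ k, μ k * (x k * ((∑ i : Fin (t + 1), C (v i) * q i).eval (x k)) ^ 2) =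
        ∑ i : Fin (t + 1), (a' i - a i) * (∏ l ∈ Finset.Ico 1 ((i : ℕ) + 1), b l) * v i ^ 2) := by
  have hH : ∀ n, 0 < ∏ l ∈ Finset.Ico 1 (n + 1), b l := fun n => Finset.prod_pos fun l _ => hb l
  have hH' : ∀ n, 0 < ∏ l ∈ Finset.Ico 1 (n + 1), b' l := fun n => Finset.prod_pos fun l _ => hb' l
  -- the scaling factors and their squares
  obtain ⟨s, hs⟩ : ∃ s : Fin (t + 1) → ℝ, s = fun (i : Fin (t + 1)) => Real.sqrt ((∏ l ∈ Finset.Ico 1 ((i : ℕ) + 1), b l) / ∏ l ∈ Finset.Ico 1 ((i : ℕ) + 1), b' l) := ⟨_, rfl⟩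
  have hus : ∀ i, u i = v i * s i := fun i => by rw [hu, hs]
  have hs2 : ∀ i : Fin (t + 1), (∏ l ∈ Finset.Ico 1 ((i : ℕ) + 1), b' l) * s i ^ 2 = ∏ l ∈ Finset.Ico 1 ((i : ℕ) + 1), b l := fun i => by
    rw [hs]; exact sqrt_rescale_sq (hH i).le (hH' i)
  -- equal couplings give equal consecutive scaling factors
  have hss : ∀ i j : Fin (t + 1), (i : ℕ) + 1 = j → b j = b' j → s j = s i := fun i j hij hbj => by
    rw [hs]
    dsimp only
    rw [← hij, prod_Ico_one_succ_succ b, prod_Ico_one_succ_succ b', hij, hbj, mul_div_mul_right _ _ (hb' j).ne']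
  have hev : ∀ (w : Fin (t + 1) → ℝ) (r : ℕ → ℝ[X]) (z : ℝ), (∑ i : Fin (t + 1), C (w i) * r i).eval z = ∑ i : Fin (t + 1), w i * (r i).eval z := fun w r z => by
    rw [eval_finsetSum]; exact Finset.sum_congr rfl fun i _ => by rw [eval_mul, eval_C]
  refine ⟨?_, fun hvb => ?_⟩
  · rw [favard_norm_sq_combination (h := fun n => ∏ l ∈ Finset.Ico 1 (n + 1), b' l) hpair' u]
    refine Finset.sum_congr rfl fun i _ => ?_
    rw [← hs2 i, hus]
    ring
  simp_rw [hev]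
  rw [weighted_sq_combination_expand μ' y (fun (i : Fin (t + 1)) k => (q' i).eval (y k)) u, weighted_sq_combination_expand μ x (fun (i : Fin (t + 1)) k => (q i).eval (x k)) v,
    ← Finset.sum_sub_distrib]
  refine Finset.sum_congr rfl fun i _ => ?_
  rw [← Finset.sum_sub_distrib]
  have hl : ∀ j : Fin (t + 1), u i * u j * ∑ k, μ' k * (y k * ((q' i).eval (y k) * (q' j).eval (y k))) - v i * v j * ∑ k, μ k * (x k * ((q i).eval (x k) * (q j).eval (x k))) =
      if i = j then (a' i - a i) * (∏ l ∈ Finset.Ico 1 ((i : ℕ) + 1), b l) * v i ^ 2 else 0 := fun j => by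
    rw [favard_x_pairing hq0' hq1' hrec' hyr hpair' i j, favard_x_pairing hq0 hq1 hrec hxr hpair i j, mul_add, mul_add, mul_add, mul_add]
    -- the three positional cases
    have huu : u i * u j = v i * v j * (s i * s j) := by rw [hus, hus]; ring
    -- cross term `j = i + 1`
    have hc1 : u i * u j * (if (i : ℕ) + 1 = j then ∏ l ∈ Finset.Ico 1 ((j : ℕ) + 1), b' l else 0) = v i * v j * (if (i : ℕ) + 1 = j then ∏ l ∈ Finset.Ico 1 ((j : ℕ) + 1), b l else 0) := by
      by_cases h1 : (i : ℕ) + 1 = j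
      · rw [if_pos h1, if_pos h1]
        by_cases hbj : b j = b' j
        · rw [huu, ← hs2 j, hss i j h1 hbj]; ring
        · rw [huu, hvb i j h1 hbj]; ring
      · rw [if_neg h1, if_neg h1, mul_zero, mul_zero]
    -- cross term `i = j + 1`
    have hc3 : u i * u j * (if (i : ℕ) = j + 1 then ∏ l ∈ Finset.Ico 1 ((i : ℕ) + 1), b' l else 0) = v i * v j * (if (i : ℕ) = j + 1 then ∏ l ∈ Finset.Ico 1 ((i : ℕ) + 1), b l else 0) := by
      by_cases h3 : (i : ℕ) = j + 1
      · rw [if_pos h3, if_pos h3]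
        by_cases hbi : b i = b' i
        · rw [huu, ← hs2 i, hss j i h3.symm hbi]; ring
        · rw [huu, show v i * v j = v j * v i from mul_comm _ _, hvb j i h3.symm hbi]; ring
      · rw [if_neg h3, if_neg h3, mul_zero, mul_zero]
    rw [hc1, hc3]
    by_cases hij : i = j
    · subst hij
      rw [if_pos rfl, if_pos rfl, if_pos rfl, huu]
      have : v i * v i * (s i * s i) * (a' i * ∏ l ∈ Finset.Ico 1 ((i : ℕ) + 1), b' l) = v i * v i * (a' i * ((∏ l ∈ Finset.Ico 1 ((i : ℕ) + 1), b' l) * s i ^ 2)) := by ring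
      rw [this, hs2 i]
      ring
    · have hij' : ¬ ((i : ℕ) = j) := fun h => hij (Fin.ext h)
      rw [if_neg hij, if_neg hij', if_neg hij', mul_zero, mul_zero]
      ring
  rw [Finset.sum_congr rfl fun j _ => hl j, Finset.sum_ite_eq]
  simp only [Finset.mem_univ, if_true]

/-- **WEYL'S UPPER INEQUALITY FOR THE ZEROS: `y_k ≤ x_{k+m}`.**  Two positive recurrences `(a, b)`, `(a', b')`; a set `Z` of at most `m` coordinates such that `a'_i ≤ a_i` off `Z` and every changed
coupling `b_{i+1} ≠ b'_{i+1}` (`i + 1 ≤ t`) has `i ∈ Z` or `i + 1 ∈ Z`; then the `k`-th zero of `q'_{t+1}` is at most the `(k+m)`-th zero of `q_{t+1}` (`k + m ≤ t`).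
[Weyl 1912; Horn–Johnson Thm 4.3.1 ∕ Cor. 4.3.9; this file, §1111] -/
theorem zeros_weyl_upper {q q' : ℕ → ℝ[X]} {a a' b b' : ℕ → ℝ} (hq0 : q 0 = 1) (hq1 : q 1 = Polynomial.X - C (a 0))
    (hrec : ∀ n, q (n + 2) = (Polynomial.X - C (a (n + 1))) * q (n + 1) - C (b (n + 1)) * q n)
    (hq0' : q' 0 = 1) (hq1' : q' 1 = Polynomial.X - C (a' 0)) (hrec' : ∀ n, q' (n + 2) = (Polynomial.X - C (a' (n + 1))) * q' (n + 1) - C (b' (n + 1)) * q' n)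
    (hb : ∀ j, 0 < b j) (hb' : ∀ j, 0 < b' j) {t m : ℕ} {Z : Finset (Fin (t + 1))} (hZm : Z.card ≤ m)
    (hZa : ∀ i : Fin (t + 1), i ∉ Z → a' i ≤ a i) (hZb : ∀ i j : Fin (t + 1), (i : ℕ) + 1 = j → b j ≠ b' j → i ∈ Z ∨ j ∈ Z)
    {x y : Fin (t + 1) → ℝ} (hx : StrictMono x) (hxq : q (t + 1) = ∏ j, (Polynomial.X - C (x j))) (hy : StrictMono y) (hyq : q' (t + 1) = ∏ j, (Polynomial.X - C (y j)))
    (k : Fin (t + 1)) (hkm : (k : ℕ) + m ≤ t) : y k ≤ x ⟨k + m, by omega⟩ := by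
  classical
  obtain ⟨μ, hμ, hpair⟩ := favard_pairing_at_zeros hq0 hq1 hrec hb hx hxq
  obtain ⟨μ', hμ', hpair'⟩ := favard_pairing_at_zeros hq0' hq1' hrec' hb' hy hyq
  have hxr : ∀ j, (q (t + 1)).eval (x j) = 0 := fun j => by
    rw [hxq, eval_prod]; exact Finset.prod_eq_zero (Finset.mem_univ j) (by rw [eval_sub, eval_X, eval_C, sub_self])
  have hyr : ∀ j, (q' (t + 1)).eval (y j) = 0 := fun j => by
    rw [hyq, eval_prod]; exact Finset.prod_eq_zero (Finset.mem_univ j) (by rw [eval_sub, eval_X, eval_C, sub_self])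
  obtain ⟨s, hs⟩ : ∃ s : Fin (t + 1) → ℝ, s = fun (i : Fin (t + 1)) => Real.sqrt ((∏ l ∈ Finset.Ico 1 ((i : ℕ) + 1), b l) / ∏ l ∈ Finset.Ico 1 ((i : ℕ) + 1), b' l) := ⟨_, rfl⟩
  -- the three families of conditions, indexed by a type of cardinality `|Z| + k + (t − k − m) ≤ t`
  obtain ⟨L, hL⟩ : ∃ L : Finset (Fin (t + 1)), L = Finset.univ.filter (fun j : Fin (t + 1) => (j : ℕ) < k) := ⟨_, rfl⟩
  obtain ⟨U, hU⟩ : ∃ U : Finset (Fin (t + 1)), U = Finset.univ.filter (fun j : Fin (t + 1) => (k : ℕ) + m < j) := ⟨_, rfl⟩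
  have hLcard : L.card = k := by rw [hL, Fin.card_filter_val_lt, min_eq_right k.is_lt.le]
  have hUcard : U.card = t - (k + m) := by
    rw [hU]
    have := card_univ_filter_val_ge (n := t + 1) (k := (k : ℕ) + m + 1) (by omega)
    rw [show t + 1 - ((k : ℕ) + m + 1) = t - (k + m) by omega] at this
    rw [← this]
    exact congrArg Finset.card (Finset.filter_congr fun j _ => by constructor <;> intro h <;> omega)
  obtain ⟨e, he⟩ : ∃ e : (Z ⊕ L) ⊕ U → Fin (t + 1) → ℝ, e = Sum.elim (Sum.elim (fun z i => if i = z.1 then 1 else 0) (fun j i => s i * (q' i).eval (y j.1)))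
      (fun j i => (q i).eval (x j.1)) := ⟨_, rfl⟩
  have hcard : Fintype.card ((Z ⊕ L) ⊕ U) < t + 1 := by
    rw [Fintype.card_sum, Fintype.card_sum, Fintype.card_coe, Fintype.card_coe, Fintype.card_coe, hLcard, hUcard]; omega
  obtain ⟨v, hv0, hv⟩ := exists_test_vector_of_card_lt e hcard
  obtain ⟨u, hu⟩ : ∃ u : Fin (t + 1) → ℝ, u = fun i => v i * s i := ⟨_, rfl⟩
  have huv : ∀ i, u i = v i * Real.sqrt ((∏ l ∈ Finset.Ico 1 ((i : ℕ) + 1), b l) / ∏ l ∈ Finset.Ico 1 ((i : ℕ) + 1), b' l) := fun i => by rw [hu, hs]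
  -- reading off the conditions
  have hvZ : ∀ i ∈ Z, v i = 0 := fun i hi => by
    have h := hv (Sum.inl (Sum.inl ⟨i, hi⟩))
    simp only [he, Sum.elim_inl] at h
    simpa only [mul_ite, mul_one, mul_zero, Finset.sum_ite_eq', Finset.mem_univ, if_true] using h
  obtain ⟨P, hP⟩ : ∃ P : ℝ[X], P = ∑ i : Fin (t + 1), C (v i) * q i := ⟨_, rfl⟩
  obtain ⟨P', hP'⟩ : ∃ P' : ℝ[X], P' = ∑ i : Fin (t + 1), C (u i) * q' i := ⟨_, rfl⟩
  have hev : ∀ (w : Fin (t + 1) → ℝ) (r : ℕ → ℝ[X]) (z : ℝ), (∑ i : Fin (t + 1), C (w i) * r i).eval z = ∑ i : Fin (t + 1), w i * (r i).eval z := fun w r z => by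
    rw [eval_finsetSum]; exact Finset.sum_congr rfl fun i _ => by rw [eval_mul, eval_C]
  have hPy : ∀ j, j < k → P'.eval (y j) = 0 := fun j hj => by
    have h := hv (Sum.inl (Sum.inr ⟨j, by rw [hL]; exact Finset.mem_filter.2 ⟨Finset.mem_univ _, hj⟩⟩))
    simp only [he, Sum.elim_inl, Sum.elim_inr] at h
    rw [hP', hev, ← h]
    exact Finset.sum_congr rfl fun i _ => by rw [hu]; ring
  have hPx : ∀ j : Fin (t + 1), (k : ℕ) + m < j → P.eval (x j) = 0 := fun j hj => by
    have h := hv (Sum.inr ⟨j, by rw [hU]; exact Finset.mem_filter.2 ⟨Finset.mem_univ _, hj⟩⟩)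
    simp only [he, Sum.elim_inr] at h
    rw [hP, hev, ← h]
  -- the support condition for the form identity
  have hvb : ∀ i j : Fin (t + 1), (i : ℕ) + 1 = j → b j ≠ b' j → v i * v j = 0 := fun i j hij hbj => by
    rcases hZb i j hij hbj with hi | hj
    · rw [hvZ i hi, zero_mul]
    · rw [hvZ j hj, mul_zero]
  obtain ⟨hG', hX⟩ := favard_forms_rescaled hq0 hq1 hrec hq0' hq1' hrec' hb hb' hxr hyr hpair hpair' v u huv
  have hX := hX hvb
  have hG : ∑ j, μ j * (P.eval (x j)) ^ 2 = ∑ i : Fin (t + 1), (∏ l ∈ Finset.Ico 1 ((i : ℕ) + 1), b l) * v i ^ 2 := by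
    rw [hP]; exact favard_norm_sq_combination (h := fun n => ∏ l ∈ Finset.Ico 1 (n + 1), b l) hpair v
  rw [← hP'] at hG' hX
  rw [← hP] at hX
  have hGpos : 0 < ∑ i : Fin (t + 1), (∏ l ∈ Finset.Ico 1 ((i : ℕ) + 1), b l) * v i ^ 2 := by
    obtain ⟨i₀, hi₀⟩ := Function.ne_iff.1 hv0
    exact Finset.sum_pos' (fun i _ => mul_nonneg (Finset.prod_nonneg fun l _ => (hb l).le) (sq_nonneg _))
      ⟨i₀, Finset.mem_univ _, mul_pos (Finset.prod_pos fun l _ => hb l) (sq_pos_iff.2 hi₀)⟩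
  -- `y_k G ≤ Σ μ' y P'²` (vanishing below `k`)
  have h1 : y k * ∑ j, μ' j * (P'.eval (y j)) ^ 2 ≤ ∑ j, μ' j * (y j * (P'.eval (y j)) ^ 2) := by
    rw [Finset.mul_sum, ← sub_nonneg, ← Finset.sum_sub_distrib]
    refine Finset.sum_nonneg fun j _ => ?_
    rw [show μ' j * (y j * (P'.eval (y j)) ^ 2) - y k * (μ' j * (P'.eval (y j)) ^ 2) = μ' j * ((y j - y k) * (P'.eval (y j)) ^ 2) by ring]
    rcases lt_or_ge j k with hjk | hjk
    · rw [hPy j hjk, sq, mul_zero, mul_zero, mul_zero]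
    · exact mul_nonneg (hμ' j).le (mul_nonneg (sub_nonneg.2 (hy.monotone hjk)) (sq_nonneg _))
  -- `Σ μ x P² ≤ x_{k+m} G` (vanishing above `k + m`)
  have h2 : ∑ j, μ j * (x j * (P.eval (x j)) ^ 2) ≤ x ⟨k + m, by omega⟩ * ∑ j, μ j * (P.eval (x j)) ^ 2 := by
    rw [Finset.mul_sum, ← sub_nonneg, ← Finset.sum_sub_distrib]
    refine Finset.sum_nonneg fun j _ => ?_
    rw [show x ⟨k + m, by omega⟩ * (μ j * (P.eval (x j)) ^ 2) - μ j * (x j * (P.eval (x j)) ^ 2) = μ j * ((x ⟨k + m, by omega⟩ - x j) * (P.eval (x j)) ^ 2) by ring]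
    by_cases hjk : (k : ℕ) + m < j
    · rw [hPx j hjk, sq, mul_zero, mul_zero, mul_zero]
    · exact mul_nonneg (hμ j).le (mul_nonneg (sub_nonneg.2 (hx.monotone (Fin.le_def.2 (by push Not at hjk; exact hjk)))) (sq_nonneg _))
  -- the Weyl difference `Σ μ' y P'² ≤ Σ μ x P²`
  have h3 : ∑ j, μ' j * (y j * (P'.eval (y j)) ^ 2) ≤ ∑ j, μ j * (x j * (P.eval (x j)) ^ 2) := by
    rw [← sub_nonpos, hX]
    refine Finset.sum_nonpos fun i _ => ?_
    by_cases hi : i ∈ Z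
    · rw [hvZ i hi]; simp
    · exact mul_nonpos_of_nonpos_of_nonneg (mul_nonpos_of_nonpos_of_nonneg (sub_nonpos.2 (hZa i hi)) (Finset.prod_nonneg fun l _ => (hb l).le)) (sq_nonneg _)
  rw [hG'] at h1
  rw [hG] at h2
  exact le_of_mul_le_mul_right ((h1.trans h3).trans h2) hGpos

/-- **WEYL'S LOWER INEQUALITY: `x_k ≤ y_{k+m}`** — the mirror statement (`a_i ≤ a'_i` off `Z`, changed couplings covered by `Z`, `|Z| ≤ m`). [Weyl 1912; Horn–Johnson Thm 4.3.1; this file, §1111] -/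
theorem zeros_weyl_lower {q q' : ℕ → ℝ[X]} {a a' b b' : ℕ → ℝ} (hq0 : q 0 = 1) (hq1 : q 1 = Polynomial.X - C (a 0))
    (hrec : ∀ n, q (n + 2) = (Polynomial.X - C (a (n + 1))) * q (n + 1) - C (b (n + 1)) * q n)
    (hq0' : q' 0 = 1) (hq1' : q' 1 = Polynomial.X - C (a' 0)) (hrec' : ∀ n, q' (n + 2) = (Polynomial.X - C (a' (n + 1))) * q' (n + 1) - C (b' (n + 1)) * q' n)
    (hb : ∀ j, 0 < b j) (hb' : ∀ j, 0 < b' j) {t m : ℕ} {Z : Finset (Fin (t + 1))} (hZm : Z.card ≤ m)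
    (hZa : ∀ i : Fin (t + 1), i ∉ Z → a i ≤ a' i) (hZb : ∀ i j : Fin (t + 1), (i : ℕ) + 1 = j → b j ≠ b' j → i ∈ Z ∨ j ∈ Z)
    {x y : Fin (t + 1) → ℝ} (hx : StrictMono x) (hxq : q (t + 1) = ∏ j, (Polynomial.X - C (x j))) (hy : StrictMono y) (hyq : q' (t + 1) = ∏ j, (Polynomial.X - C (y j)))
    (k : Fin (t + 1)) (hkm : (k : ℕ) + m ≤ t) : x k ≤ y ⟨k + m, by omega⟩ :=
  zeros_weyl_upper hq0' hq1' hrec' hq0 hq1 hrec hb' hb hZm hZa (fun i j hij hbj => hZb i j hij (Ne.symm hbj)) hy hyq hx hxq k hkm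

/-- **RANK-ONE INTERLACING: raising ONE diagonal coefficient `a_{i₀} ≤ a'_{i₀}` (all other `a_i`, all `b_j` unchanged) gives `x_k ≤ y_k ≤ x_{k+1}`.**
[Horn–Johnson Cor. 4.3.9; Parlett §10.3; Ismail §7.3; this file, §1111] -/
theorem zeros_rank_one_interlace {q q' : ℕ → ℝ[X]} {a a' b : ℕ → ℝ} (hq0 : q 0 = 1) (hq1 : q 1 = Polynomial.X - C (a 0))
    (hrec : ∀ n, q (n + 2) = (Polynomial.X - C (a (n + 1))) * q (n + 1) - C (b (n + 1)) * q n)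
    (hq0' : q' 0 = 1) (hq1' : q' 1 = Polynomial.X - C (a' 0)) (hrec' : ∀ n, q' (n + 2) = (Polynomial.X - C (a' (n + 1))) * q' (n + 1) - C (b (n + 1)) * q' n)
    (hb : ∀ j, 0 < b j) {i₀ : ℕ} (hi₀ : a i₀ ≤ a' i₀) (ha : ∀ i, i ≠ i₀ → a' i = a i) {t : ℕ}
    {x y : Fin (t + 1) → ℝ} (hx : StrictMono x) (hxq : q (t + 1) = ∏ j, (Polynomial.X - C (x j))) (hy : StrictMono y) (hyq : q' (t + 1) = ∏ j, (Polynomial.X - C (y j)))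
    (k : Fin (t + 1)) : x k ≤ y k ∧ ∀ hk : (k : ℕ) + 1 ≤ t, y k ≤ x ⟨k + 1, by omega⟩ := by
  classical
  refine ⟨zeros_mono_diagonal hq0 hq1 hrec hq0' hq1' hrec' hb (fun i _ => ?_) hx hxq hy hyq k, fun hk => ?_⟩
  · by_cases h : i = i₀
    · rw [h]; exact hi₀
    · rw [ha i h]
  · refine zeros_weyl_upper hq0 hq1 hrec hq0' hq1' hrec' hb hb (Z := Finset.univ.filter (fun i : Fin (t + 1) => (i : ℕ) = i₀)) (m := 1) ?_ (fun i hi => ?_) (fun i j _ hbj => absurd rfl hbj)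
      hx hxq hy hyq k hk
    · rw [Finset.card_le_one]
      intro i hi j hj
      exact Fin.ext ((Finset.mem_filter.1 hi).2.trans (Finset.mem_filter.1 hj).2.symm)
    · have h : (i : ℕ) ≠ i₀ := fun h => hi (Finset.mem_filter.2 ⟨Finset.mem_univ _, h⟩)
      rw [ha i h]

/-- **A SINGLE COUPLING MOVES EVERY ZERO BY AT MOST ONE PLACE: same `a`, `b'_j = b_j` for `j ≠ j₀` (`b_{j₀}, b'_{j₀} > 0` arbitrary) gives `y_k ≤ x_{k+1}` and `x_k ≤ y_{k+1}`** (the change is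
symmetric of rank two with one eigenvalue of each sign). [Weyl 1912; Horn–Johnson Thm 4.3.1; this file, §1111] -/
theorem zeros_single_coupling_interlace {q q' : ℕ → ℝ[X]} {a b b' : ℕ → ℝ} (hq0 : q 0 = 1) (hq1 : q 1 = Polynomial.X - C (a 0))
    (hrec : ∀ n, q (n + 2) = (Polynomial.X - C (a (n + 1))) * q (n + 1) - C (b (n + 1)) * q n)
    (hq0' : q' 0 = 1) (hq1' : q' 1 = Polynomial.X - C (a 0)) (hrec' : ∀ n, q' (n + 2) = (Polynomial.X - C (a (n + 1))) * q' (n + 1) - C (b' (n + 1)) * q' n)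
    (hb : ∀ j, 0 < b j) (hb' : ∀ j, 0 < b' j) {j₀ : ℕ} (hbj : ∀ j, j ≠ j₀ → b' j = b j) {t : ℕ}
    {x y : Fin (t + 1) → ℝ} (hx : StrictMono x) (hxq : q (t + 1) = ∏ j, (Polynomial.X - C (x j))) (hy : StrictMono y) (hyq : q' (t + 1) = ∏ j, (Polynomial.X - C (y j)))
    (k : Fin (t + 1)) (hk : (k : ℕ) + 1 ≤ t) : y k ≤ x ⟨k + 1, by omega⟩ ∧ x k ≤ y ⟨k + 1, by omega⟩ := by
  classical
  have hZm : (Finset.univ.filter (fun i : Fin (t + 1) => (i : ℕ) + 1 = j₀)).card ≤ 1 := by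
    rw [Finset.card_le_one]
    intro i hi j hj
    exact Fin.ext (by have := (Finset.mem_filter.1 hi).2; have := (Finset.mem_filter.1 hj).2; omega)
  have hZb : ∀ i j : Fin (t + 1), (i : ℕ) + 1 = j → b j ≠ b' j → i ∈ Finset.univ.filter (fun i : Fin (t + 1) => (i : ℕ) + 1 = j₀) ∨ j ∈ Finset.univ.filter (fun i : Fin (t + 1) => (i : ℕ) + 1 = j₀) :=
    fun i j hij hne => by
      have hj : (j : ℕ) = j₀ := by
        by_contra h
        exact hne (hbj j h).symm
      exact Or.inl (Finset.mem_filter.2 ⟨Finset.mem_univ _, hij.trans hj⟩)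
  exact ⟨zeros_weyl_upper hq0 hq1 hrec hq0' hq1' hrec' hb hb' hZm (fun i _ => le_rfl) hZb hx hxq hy hyq k hk,
    zeros_weyl_lower hq0 hq1 hrec hq0' hq1' hrec' hb hb' hZm (fun i _ => le_rfl) hZb hx hxq hy hyq k hk⟩

/-- **DIAGONAL CHANGES ON A SET `S` OF AT MOST `m` INDICES (same `b`): `a'_i ≤ a_i` off `S` ⇒ `y_k ≤ x_{k+m}`.** [Weyl 1912; Horn–Johnson Cor. 4.3.9; this file, §1111] -/
theorem zeros_diagonal_support_upper {q q' : ℕ → ℝ[X]} {a a' b : ℕ → ℝ} (hq0 : q 0 = 1) (hq1 : q 1 = Polynomial.X - C (a 0))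
    (hrec : ∀ n, q (n + 2) = (Polynomial.X - C (a (n + 1))) * q (n + 1) - C (b (n + 1)) * q n)
    (hq0' : q' 0 = 1) (hq1' : q' 1 = Polynomial.X - C (a' 0)) (hrec' : ∀ n, q' (n + 2) = (Polynomial.X - C (a' (n + 1))) * q' (n + 1) - C (b (n + 1)) * q' n)
    (hb : ∀ j, 0 < b j) {S : Finset ℕ} {m : ℕ} (hSm : S.card ≤ m) (hSa : ∀ i, i ∉ S → a' i ≤ a i) {t : ℕ}
    {x y : Fin (t + 1) → ℝ} (hx : StrictMono x) (hxq : q (t + 1) = ∏ j, (Polynomial.X - C (x j))) (hy : StrictMono y) (hyq : q' (t + 1) = ∏ j, (Polynomial.X - C (y j)))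
    (k : Fin (t + 1)) (hkm : (k : ℕ) + m ≤ t) : y k ≤ x ⟨k + m, by omega⟩ := by
  classical
  have hZm : (Finset.univ.filter (fun i : Fin (t + 1) => (i : ℕ) ∈ S)).card ≤ m := by
    refine le_trans (Finset.card_le_card_of_injOn (fun i : Fin (t + 1) => (i : ℕ)) (fun i hi => (Finset.mem_filter.1 hi).2) fun i _ j _ h => Fin.ext h) hSm
  exact zeros_weyl_upper hq0 hq1 hrec hq0' hq1' hrec' hb hb hZm (fun i hi => hSa i fun h => hi (Finset.mem_filter.2 ⟨Finset.mem_univ _, h⟩)) (fun i j _ hbj => absurd rfl hbj)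
    hx hxq hy hyq k hkm

/-- **Same `b`, `a_i ≤ a'_i` off a set `S` of at most `m` indices ⇒ `x_k ≤ y_{k+m}`.** [Weyl 1912; this file, §1111] -/
theorem zeros_diagonal_support_lower {q q' : ℕ → ℝ[X]} {a a' b : ℕ → ℝ} (hq0 : q 0 = 1) (hq1 : q 1 = Polynomial.X - C (a 0))
    (hrec : ∀ n, q (n + 2) = (Polynomial.X - C (a (n + 1))) * q (n + 1) - C (b (n + 1)) * q n)
    (hq0' : q' 0 = 1) (hq1' : q' 1 = Polynomial.X - C (a' 0)) (hrec' : ∀ n, q' (n + 2) = (Polynomial.X - C (a' (n + 1))) * q' (n + 1) - C (b (n + 1)) * q' n)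
    (hb : ∀ j, 0 < b j) {S : Finset ℕ} {m : ℕ} (hSm : S.card ≤ m) (hSa : ∀ i, i ∉ S → a i ≤ a' i) {t : ℕ}
    {x y : Fin (t + 1) → ℝ} (hx : StrictMono x) (hxq : q (t + 1) = ∏ j, (Polynomial.X - C (x j))) (hy : StrictMono y) (hyq : q' (t + 1) = ∏ j, (Polynomial.X - C (y j)))
    (k : Fin (t + 1)) (hkm : (k : ℕ) + m ≤ t) : x k ≤ y ⟨k + m, by omega⟩ :=
  zeros_diagonal_support_upper hq0' hq1' hrec' hq0 hq1 hrec hb hSm hSa hy hyq hx hxq k hkm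

end Summit.Ventures.HSemireg.Wedge.HankelOuter
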